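import Mathlib
import Summits.Ventures.HodgeRepro.Tier4.Target
import Summits.Ventures.HodgeRepro.Tier4.Line3.KMDatum
import Summits.Ventures.HodgeRepro.Tier4.Line3.Majorant

/-!
# Tier4/Line3/MajorantNorm — the majorant controls the Euclidean norm: `(1 − |z|²) ‖y‖² ≤ 4 maj y z`
(rung for L3.5, the residual (vi))

Blind re-derivation cell `pub-hodge-repro`, Tier 4 «PROVE THE STEP» (README §9–§10), LINE L3, seat t4-L2-p3 on L3.5
`term_dominated` (lead S12234).

The uniform majorant of the class bound carries the NON-invariant prefactor `∏_j (1 + ‖y_j‖)^e (Σ_i ‖y_j i‖)²` (the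
polynomial growth of `Loc.growth` and of the datum); to bound it by the INVARIANT Gaussians on an arbitrary fundamental
domain one needs `‖y‖² ≲ maj(y, z)/(1 − |z|²)` — the minimal eigenvalue of the majorant form is
`(1 − |z|)/(1 + |z|) ≥ (1 − |z|²)/4`.  Proof (`nsq_mul_norm_sq_le_maj`): with `p² = |y₀|² + |y₁|²`, `q = |y₂|`,
`u = z̄₀ y₀ + z̄₁ y₁`, `v = |u| ≤ |z| p` (`Majorant.lagrange`), `s = |z|²`, `t = 1 − s`,
`maj = p² − q² + 2|u − y₂|²/t ≥ p² − q² + 2(q − v)²/t`, and the polynomial certificate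

  `s B F = B (4t − t²)(s p² − v²) + (B v − 8 s q)² + s q² (8t³ + t⁴)`,   `B = 8 − 4t − t²`,

for `F = 4t(p² − q²) + 8(q − v)² − t²(p² + q²)` shows `F ≥ 0`, i.e. `t(p² + q²) ≤ 4(p² − q²) + 8(q − v)²/t ≤ 4 maj`.

Nothing here asserts anything about the truth of (P); HC_CM is NOT proved by anyone in this repository.
-/

set_option autoImplicit false

namespace Summit.Ventures.HodgeRepro.Tier4.Line3

open Matrix
open scoped ComplexConjugate

/-- The real certificate: for `0 ≤ s < 1`, `t = 1 − s`, `p, q, v ≥ 0`, `v² ≤ s p²`,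
`t (p² + q²) ≤ 4 (p² − q²) + 8 (q − v)² / t`. -/
theorem certificate_norm_le_maj {s p q v : ℝ} (hs0 : 0 ≤ s) (hs1 : s < 1) (hv : 0 ≤ v)
    (hvs : v ^ 2 ≤ s * p ^ 2) :
    (1 - s) * (p ^ 2 + q ^ 2) ≤ 4 * (p ^ 2 - q ^ 2) + 8 * (q - v) ^ 2 / (1 - s) := by
  have ht : 0 < 1 - s := by linarith
  set t := 1 - s with htdef
  have hB : 0 < 8 - 4 * t - t ^ 2 := by nlinarith
  have h4t : 0 ≤ 4 * t - t ^ 2 := by nlinarith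
  -- `F ≥ 0` through the certificate
  have hF : 0 ≤ 4 * t * (p ^ 2 - q ^ 2) + 8 * (q - v) ^ 2 - t ^ 2 * (p ^ 2 + q ^ 2) := by
    rcases eq_or_lt_of_le hs0 with hs | hs
    · -- `s = 0`: `v = 0`, `t = 1`
      have hv0 : v = 0 := by nlinarith
      have ht1 : t = 1 := by rw [htdef, ← hs]; ring
      rw [hv0, ht1]
      nlinarith
    · have hkey : s * (8 - 4 * t - t ^ 2) * (4 * t * (p ^ 2 - q ^ 2) + 8 * (q - v) ^ 2 - t ^ 2 * (p ^ 2 + q ^ 2)) =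
          (8 - 4 * t - t ^ 2) * (4 * t - t ^ 2) * (s * p ^ 2 - v ^ 2) + ((8 - 4 * t - t ^ 2) * v - 8 * s * q) ^ 2 +
            s * q ^ 2 * (8 * t ^ 3 + t ^ 4) := by
        rw [htdef]
        ring
      have hpos : 0 ≤ s * (8 - 4 * t - t ^ 2) *
          (4 * t * (p ^ 2 - q ^ 2) + 8 * (q - v) ^ 2 - t ^ 2 * (p ^ 2 + q ^ 2)) := by
        rw [hkey]
        have h1 : 0 ≤ (8 - 4 * t - t ^ 2) * (4 * t - t ^ 2) * (s * p ^ 2 - v ^ 2) :=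
          mul_nonneg (mul_nonneg hB.le h4t) (by linarith)
        have h2 : 0 ≤ ((8 - 4 * t - t ^ 2) * v - 8 * s * q) ^ 2 := sq_nonneg _
        have h3 : 0 ≤ s * q ^ 2 * (8 * t ^ 3 + t ^ 4) := by positivity
        linarith
      exact nonneg_of_mul_nonneg_right hpos (by positivity)
  -- divide by `t`
  have hdiv : 0 ≤ (4 * t * (p ^ 2 - q ^ 2) + 8 * (q - v) ^ 2 - t ^ 2 * (p ^ 2 + q ^ 2)) / t := div_nonneg hF ht.le
  have e : (4 * t * (p ^ 2 - q ^ 2) + 8 * (q - v) ^ 2 - t ^ 2 * (p ^ 2 + q ^ 2)) / t =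
      4 * (p ^ 2 - q ^ 2) + 8 * (q - v) ^ 2 / t - t * (p ^ 2 + q ^ 2) := by
    field_simp
  rw [e] at hdiv
  linarith

/-- **THE MAJORANT CONTROLS THE EUCLIDEAN NORM.** `(1 − |z|²) (|y₀|² + |y₁|² + |y₂|²) ≤ 4 maj y z` on the ball. -/
theorem nsq_mul_norm_sq_le_maj (y : Fin 3 → ℂ) (z : Fin 2 → ℂ) (hz : z ∈ ball) :
    (1 - nsq z) * (‖y 0‖ ^ 2 + ‖y 1‖ ^ 2 + ‖y 2‖ ^ 2) ≤ 4 * maj y z := by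
  have hs1 : nsq z < 1 := hz
  have hs0 : 0 ≤ nsq z := by unfold nsq; positivity
  unfold maj
  rw [hformJ_re, liftJ_eq]
  set u := conj (z 0) * y 0 + conj (z 1) * y 1 with hu
  set s := nsq z with hsdef
  -- `‖u − y₂‖ ≥ q − v`
  have htri : (‖y 2‖ - ‖u‖) ^ 2 ≤ ‖u - y 2‖ ^ 2 := by
    have h := abs_norm_sub_norm_le u (y 2)
    rw [abs_sub_comm] at h
    have h' : |‖y 2‖ - ‖u‖| ^ 2 ≤ ‖u - y 2‖ ^ 2 := by
      exact pow_le_pow_left₀ (abs_nonneg _) h 2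
    rwa [sq_abs] at h'
  -- Lagrange: `v² ≤ s p²` with `p² = |y₀|² + |y₁|²`; write `p = √(p²)`
  have hL : ‖u‖ ^ 2 ≤ s * (‖y 0‖ ^ 2 + ‖y 1‖ ^ 2) := lagrange z y
  set p : ℝ := Real.sqrt (‖y 0‖ ^ 2 + ‖y 1‖ ^ 2) with hp
  have hp2 : p ^ 2 = ‖y 0‖ ^ 2 + ‖y 1‖ ^ 2 := Real.sq_sqrt (by positivity)
  have hcert := certificate_norm_le_maj (q := ‖y 2‖) hs0 hs1 (norm_nonneg u) (by rw [hp2]; exact hL)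
  rw [hp2] at hcert
  have ht : 0 < 1 - s := by linarith
  have hmono : 8 * (‖y 2‖ - ‖u‖) ^ 2 / (1 - s) ≤ 8 * ‖u - y 2‖ ^ 2 / (1 - s) := by
    apply div_le_div_of_nonneg_right _ ht.le
    linarith
  have e : 2 * ‖u - y 2‖ ^ 2 / (1 - s) * 4 = 8 * ‖u - y 2‖ ^ 2 / (1 - s) := by ring
  nlinarith [hcert, hmono, e]

end Summit.Ventures.HodgeRepro.Tier4.Line3
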